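import Summits.BirchSwinnertonDyer.BirchSwinnertonDyer.Theorems.SylvesterTwoHeegnerIndexHSYPointLower
import Summits.BirchSwinnertonDyer.BirchSwinnertonDyer.Theorems.SylvesterTwoHeegnerIndexLowerHalfFourTorsionMembers
import HarnessLib

/-!
# Route `SylvesterTwoHeegnerIndex` (rung K7t), LOWER crux 19477 `HeegnerIndexLowerAtTwoHSYOfFacts`:
# the MEMBER-LEVEL consumer in Heegner-INDEX currency — «the 2-divisibility index of Hu–Shu–Yin's point
# at ONE member bounds #Ш_an there» — and the first rows decided by the Heegner engine itself

Cell `bsd-cm`, lane `bsd-cm-k7t-c3x` (prover-bsd-cm-k7t-c3x-g0-0; WIDTH-LEVER second lane on item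
stmt-BirchSwinnertonDyer-19477, director-bsd 2026-08-27: «certificate road — explicit Heegner-point
height / index tables at 2»). PARTITION (D-0054): CornerF at `p = 2` (B14/O12) × 𝒞_HSY × `p = 2` —
supplies-certificate-for (`--supports stmt-BirchSwinnertonDyer-19477 --as helper`); closes no cell and
no item; BSD is not claimed. Everything here is PROVED: no definition, no named fact, no `sorry`.

WHAT IS NEW. The cell's kernel already has (i) the CLASS-LEVEL equivalence «LOWER stub ⟺ point bound»
granted Hu–Shu–Yin's printed display (`SylvesterTwoYinLower.pairLeZeroOnV0_iff_pointBoundOnV0`, k7t-c2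
p515742) and (ii) MEMBER-LEVEL certificate consumers in `#Ш_an`-currency (`SylvesterTwoLowerCert.lower_member_of_cert`,
k7t-c3): a row there displays the ANALYTIC order `#Ш_an(E_p) = q` (an `L′(E_p,1)` computation). This
file is the member-level consumer in the OTHER currency: its displayed per-member hypothesis is a bound on
the `2`-power divisibility of Hu–Shu–Yin's Heegner point `Y ∈ E_p(K)` — the quantity the lane's
Heegner-Index Table (HIT2, kit j277473/j277477; HIT2-GEN j277728) MEASURES by evaluating the CM point on
`X_0(243)`, with no `L`-value of `E_p` — and its conclusion is the child cruxes' body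
`MissingLowerBoundAt B 2` at that member:

* §1 `missingLowerBoundAt_of_pointBound` — at a member pair `(A, B)`, granted the three route facts used
  by the pair identity (HSY Thm 1.4, Burungale–Flach, modularity) and Hu–Shu–Yin's printed display BY NAME:
  if at every display datum `(K ∋ ω, P₀, Y)` every `2^j ∣ Y (mod torsion)` has
  `i + 2j ≤ ord₂#Ш(B)[2^∞] + ord₂#Ш(A)[2^∞]`, then `MissingLowerBoundAt B 2`.
* §2 the two Ш-FREE special cases that the table's `𝒱₀`-rows instantiate:
  `missingLowerBoundAt_of_twoPrimitive` (`p ≡ 4 (9)`: Y is `2`-PRIMITIVE ⟹ LOWER at the member — no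
  hypothesis on Ш at all, since `2m + i = 0 ≤` anything) and `missingLowerBoundAt_of_not_fourDivisible`
  (`p ≡ 7 (9)`: `Y ∉ 4·E_p(K) + tors` ⟹ LOWER at the member; one factor `2` is THEOREM C's).
* §3 ROWS: the first two 𝒞_HSY members at which NO engine of the cell had a generator (two's N5′-ext:
  «no generator within 1800 s») and which the Heegner engine decided by itself (HIT2-GEN j277664/j277728:
  the generator is RECOVERED from `Y`, `ĥ(P) = 78.41` resp. `105.95`, and `Y ≡ [13ζ]P`, `Y ≡ [ζ]P`, so
  `m = 0`): `p = 7879`, `p = 9643` (both `≡ 4 (9)`, both in the unit subclass 𝒰). The displayed hypothesis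
  of each row is «Hu–Shu–Yin's point is `2`-primitive at this member» — an exact algebraic statement about
  one explicit point, NOT proved in the kernel (the tree's display fact asserts `Y` to EXIST only).

HONEST READING. Per-member, conditional, evidence-consuming; the class-level crux stays OPEN (Kolyvagin-
conjecture direction at the inert prime `2`, memo two §22.3). In the kernel the two currencies are
inter-derivable through the display (k7t-c2's iff); what differs is the PROVENANCE of the displayed number
(a CM-point evaluation instead of an `L′(E_p,1)` evaluation) — the two-engine standard of the cell applied
to the LOWER crux's own object.

References: Hu–Shu–Yin, Trans. AMS 372 (2019) = arXiv:1708.05266, Cor. 4.4, (bsd) p. 12, p. 8;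
Burungale–Flach, Camb. J. Math. 12 (2024) Thm 1.1/Cor. 2; Miller, LMS J. Comput. Math. 14 (2011) Def. 1.1;
MEMO bsd-cm-two §15 (Thm B/B′), §16.2 (N6); this lane's HIT2-PREREG / HIT2-GEN-PREREG (HOME/bsd-cm-k7t-c3x/g0/).
-/

set_option autoImplicit false
-- the Summit-side namespace `Summit.BirchSwinnertonDyer.BirchSwinnertonDyer.…` (summit = problem) is mandated by D-0017
set_option linter.dupNamespace false

noncomputable section

open scoped Classical

open WeierstrassCurve WeierstrassCurve.Affine WeierstrassCurve.Affine.Point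
  Literature.NumberTheory.EllipticCurves Literature.NumberTheory.EllipticCurves.HuShuYin2019
  Literature.NumberTheory.EllipticCurves.Rank1Residual.Typed
  Summit.BirchSwinnertonDyer.BirchSwinnertonDyer.Theorems.SylvesterTwoCMNormForm
  Summit.BirchSwinnertonDyer.BirchSwinnertonDyer.Theorems.SylvesterTwoThmCAssembly

namespace Summit.BirchSwinnertonDyer.BirchSwinnertonDyer.Theorems.SylvesterTwoPointIndex

/-! ## §1 The member-level consumer: a point-divisibility bound at ONE pair gives `MissingLowerBoundAt B 2` -/

section Member

variable {p : ℕ}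

/-- **Point bound at a member ⟹ LOWER at the member.** For a prime `p ≡ 4, 7 (9)` with `3 ∉ 𝔽_p^{×3}`,
globally minimal `B ≅ E_p`, `A ≅ E_{3p²}`, granted Hu–Shu–Yin Thm 1.4, Burungale–Flach, modularity and
Hu–Shu–Yin's printed display `hH` (BY NAME): if at every display datum `(K, ω, P₀, Y)` with the analytic
orders `qB = #Ш_an(B)`, `qA = #Ш_an(A)`, every `j` with `Y ∈ 2^j·B(K) + tors` satisfies
`i + 2j ≤ ord₂#Ш(B)[2^∞] + ord₂#Ш(A)[2^∞]` (`i = 0 | −2`), then `MissingLowerBoundAt B 2`. Proof: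
the display datum exists (`hH` at `K = ℚ(ζ₃)`); k7t-c2's `padicValRat_le_iff_forall_powDivisible` turns the
point bound into `ord₂(qB·qA) ≤ s_B + s_A`; x1b's `SylvesterTwoUpper.missingLowerBoundAt_iff_pairBound`
turns that into the LOWER body. [cite: HuShuYin2019, display (bsd) p. 12 with Cor. 4.4, p. 8]
[cite: BurungaleFlach2024, Thm. 1.1 and Cor. 2] [cite: Miller2011LMS, Def. 1.1] -/
theorem missingLowerBoundAt_of_pointBound (hH : shaAnPair_mul_height_eq_two_zpow_mul_height)
    (hHSY : thm14_threePart_product) (hCM0 : bsdTriple_of_hasCM_of_L_one_ne_zero)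
    (hmod : hasEntireLFunction_rat) (hp : p.Prime) (h9 : p % 9 = 4 ∨ p % 9 = 7)
    (h3 : ¬ ∃ x : ZMod p, x ^ 3 = 3) (A B : WeierstrassCurve ℚ) [A.IsElliptic] [A.IsGloballyMinimal]
    [B.IsElliptic] [B.IsGloballyMinimal] (hB : ∃ C : VariableChange ℚ, C • B = cubeSumCurve (p : ℚ))
    (hA : ∃ C : VariableChange ℚ, C • A = cubeSumCurve (3 * (p : ℚ) ^ 2))
    (hpt : ∀ (qB qA : ℚ), shaAn B = (qB : ℂ) → shaAn A = (qA : ℂ) →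
      ∀ (K : Type) [Field K] [NumberField K] (ω : K), ω ^ 2 + ω + 1 = 0 → Module.finrank ℚ K = 2 →
      ∀ (P₀ : B.toAffine.Point), ¬ IsOfFinAddOrder (QuadraticDescent.incl K B P₀) →
        (∀ Q : B.toAffine.Point, ∃ m : ℤ,
          IsOfFinAddOrder (QuadraticDescent.incl K B Q - m • QuadraticDescent.incl K B P₀)) →
      ∀ (Y : (B.baseChange K).toAffine.Point),
        ((qB * qA : ℚ) : ℝ) * canonicalHeight (QuadraticDescent.incl K B P₀) =
          (2 : ℝ) ^ (if p % 9 = 4 then (0 : ℤ) else -2) * canonicalHeight Y →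
      ∀ j : ℕ, (∃ Y' T' : (B.baseChange K).toAffine.Point,
          IsOfFinAddOrder T' ∧ Y = ((2 : ℤ) ^ j) • Y' + T') →
        (if p % 9 = 4 then (0 : ℤ) else -2) + 2 * (j : ℤ) ≤
          (padicValNat 2 (Nat.card (AddCommGroup.primaryComponent B.sha 2)) : ℤ) +
            (padicValNat 2 (Nat.card (AddCommGroup.primaryComponent A.sha 2)) : ℤ)) :
    MissingLowerBoundAt B 2 := by
  obtain ⟨ω, hω⟩ := exists_omega_cyclotomicField_three
  have h2K := finrank_cyclotomicField_three
  obtain ⟨qB, qA, hqB, hqA, hne, hrank, P, Y, hP, hgen, hid⟩ :=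
    hH p hp h9 h3 A B hB hA (CyclotomicField 3 ℚ) ω hω h2K
  have hB' := hB
  obtain ⟨C, hC⟩ := hB'
  have hp2 : p ≠ 2 := SylvesterTwoLower.ne_two_of_mod_nine h9
  have hle := (SylvesterTwoYinLower.padicValRat_le_iff_forall_powDivisible hω h2K hp hp2 B C hC hrank P
    hP hgen Y hne (SylvesterTwoYin.even_displayExponent p) hid _).mpr
    (hpt qB qA hqB hqA (CyclotomicField 3 ℚ) ω hω h2K P hP hgen Y hid)
  exact (SylvesterTwoUpper.missingLowerBoundAt_iff_pairBound hHSY hCM0 hmod hp h9 h3 A B hB hA).mpr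
    ⟨qB, qA, hqB, hqA, hne, hle⟩

/-! ## §2 The Ш-free special cases: `2`-primitivity (`p ≡ 4 (9)`), non-`4`-divisibility (`p ≡ 7 (9)`) -/

/-- **`p ≡ 4 (mod 9)`: Hu–Shu–Yin's point `2`-PRIMITIVE at the member ⟹ LOWER at the member**, with NO
hypothesis on Ш: if at every display datum `Y ∉ 2·B(K) + tors`, then `i + 2j = 2j ≤ 0` forces `j = 0`, and
`0 ≤ s_B + s_A` always. This is the kernel face of a `𝒱₀`-row of the lane's Heegner-Index Table
(`m_direct = 0`), and — read at every member — of the registered stub `stub_hsyPointBound_fourModNine`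
(VARIANT P). [cite: HuShuYin2019, display (bsd) p. 12 with Cor. 4.4, p. 8]
[cite: BurungaleFlach2024, Thm. 1.1 and Cor. 2] [cite: Miller2011LMS, Def. 1.1] -/
theorem missingLowerBoundAt_of_twoPrimitive (hH : shaAnPair_mul_height_eq_two_zpow_mul_height)
    (hHSY : thm14_threePart_product) (hCM0 : bsdTriple_of_hasCM_of_L_one_ne_zero)
    (hmod : hasEntireLFunction_rat) (hp : p.Prime) (h4 : p % 9 = 4)
    (h3 : ¬ ∃ x : ZMod p, x ^ 3 = 3) (A B : WeierstrassCurve ℚ) [A.IsElliptic] [A.IsGloballyMinimal]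
    [B.IsElliptic] [B.IsGloballyMinimal] (hB : ∃ C : VariableChange ℚ, C • B = cubeSumCurve (p : ℚ))
    (hA : ∃ C : VariableChange ℚ, C • A = cubeSumCurve (3 * (p : ℚ) ^ 2))
    (hprim : ∀ (qB qA : ℚ), shaAn B = (qB : ℂ) → shaAn A = (qA : ℂ) →
      ∀ (K : Type) [Field K] [NumberField K] (ω : K), ω ^ 2 + ω + 1 = 0 → Module.finrank ℚ K = 2 →
      ∀ (P₀ : B.toAffine.Point), ¬ IsOfFinAddOrder (QuadraticDescent.incl K B P₀) →
        (∀ Q : B.toAffine.Point, ∃ m : ℤ,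
          IsOfFinAddOrder (QuadraticDescent.incl K B Q - m • QuadraticDescent.incl K B P₀)) →
      ∀ (Y : (B.baseChange K).toAffine.Point),
        ((qB * qA : ℚ) : ℝ) * canonicalHeight (QuadraticDescent.incl K B P₀) =
          (2 : ℝ) ^ (if p % 9 = 4 then (0 : ℤ) else -2) * canonicalHeight Y →
      ¬ ∃ Y' T' : (B.baseChange K).toAffine.Point, IsOfFinAddOrder T' ∧ Y = (2 : ℤ) • Y' + T') :
    MissingLowerBoundAt B 2 := by
  refine missingLowerBoundAt_of_pointBound hH hHSY hCM0 hmod hp (Or.inl h4) h3 A B hB hA ?_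
  intro qB qA hqB hqA K _ _ ω hω h2K P₀ hP hgen Y hid j hdiv
  rw [if_pos h4]
  rcases j with _ | j
  · simp only [Nat.cast_zero, mul_zero, zero_add]
    positivity
  · exfalso
    obtain ⟨Y', T', hT', hY⟩ := hdiv
    refine hprim qB qA hqB hqA K ω hω h2K P₀ hP hgen Y hid ⟨((2 : ℤ) ^ j) • Y', T', hT', ?_⟩
    rw [hY, smul_smul, ← pow_succ']

/-- **`p ≡ 7 (mod 9)`: Hu–Shu–Yin's point NOT in `4·B(K) + tors` at the member ⟹ LOWER at the member**,
again with no hypothesis on Ш (`i = −2`: `j ≤ 1` gives `−2 + 2j ≤ 0`). One factor `2` of `Y` is THEOREM C's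
(`Y ∈ 2·E_p(K) + E_p(K)[3]` for every `p ≡ 7 (9)`); the displayed hypothesis says there is no second one —
the `𝒱₀`-row reading `m_direct = 1` of the table. [cite: HuShuYin2019, display (bsd) p. 12 with Cor. 4.4, p. 8]
[cite: BurungaleFlach2024, Thm. 1.1 and Cor. 2] [cite: Miller2011LMS, Def. 1.1] -/
theorem missingLowerBoundAt_of_not_fourDivisible (hH : shaAnPair_mul_height_eq_two_zpow_mul_height)
    (hHSY : thm14_threePart_product) (hCM0 : bsdTriple_of_hasCM_of_L_one_ne_zero)
    (hmod : hasEntireLFunction_rat) (hp : p.Prime) (h7 : p % 9 = 7)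
    (h3 : ¬ ∃ x : ZMod p, x ^ 3 = 3) (A B : WeierstrassCurve ℚ) [A.IsElliptic] [A.IsGloballyMinimal]
    [B.IsElliptic] [B.IsGloballyMinimal] (hB : ∃ C : VariableChange ℚ, C • B = cubeSumCurve (p : ℚ))
    (hA : ∃ C : VariableChange ℚ, C • A = cubeSumCurve (3 * (p : ℚ) ^ 2))
    (hn4 : ∀ (qB qA : ℚ), shaAn B = (qB : ℂ) → shaAn A = (qA : ℂ) →
      ∀ (K : Type) [Field K] [NumberField K] (ω : K), ω ^ 2 + ω + 1 = 0 → Module.finrank ℚ K = 2 →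
      ∀ (P₀ : B.toAffine.Point), ¬ IsOfFinAddOrder (QuadraticDescent.incl K B P₀) →
        (∀ Q : B.toAffine.Point, ∃ m : ℤ,
          IsOfFinAddOrder (QuadraticDescent.incl K B Q - m • QuadraticDescent.incl K B P₀)) →
      ∀ (Y : (B.baseChange K).toAffine.Point),
        ((qB * qA : ℚ) : ℝ) * canonicalHeight (QuadraticDescent.incl K B P₀) =
          (2 : ℝ) ^ (if p % 9 = 4 then (0 : ℤ) else -2) * canonicalHeight Y →
      ¬ ∃ Y' T' : (B.baseChange K).toAffine.Point, IsOfFinAddOrder T' ∧ Y = (4 : ℤ) • Y' + T') :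
    MissingLowerBoundAt B 2 := by
  have h4 : ¬ p % 9 = 4 := by omega
  refine missingLowerBoundAt_of_pointBound hH hHSY hCM0 hmod hp (Or.inr h7) h3 A B hB hA ?_
  intro qB qA hqB hqA K _ _ ω hω h2K P₀ hP hgen Y hid j hdiv
  rw [if_neg h4]
  rcases Nat.lt_or_ge j 2 with hj | hj
  · have h1 : (-2 : ℤ) + 2 * (j : ℤ) ≤ 0 := by omega
    exact h1.trans (by positivity)
  · exfalso
    obtain ⟨Y', T', hT', hY⟩ := hdiv
    obtain ⟨k, rfl⟩ := Nat.exists_eq_add_of_le hj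
    refine hn4 qB qA hqB hqA K ω hω h2K P₀ hP hgen Y hid ⟨((2 : ℤ) ^ k) • Y', T', hT', ?_⟩
    rw [hY, smul_smul]
    congr 1
    ring

end Member

/-! ## §3 Rows: the first members decided by the Heegner engine alone (HIT2-GEN, kit j277664 / j277728) -/

/-- `7879` is an 𝒞_HSY parameter: prime, `7879 ≡ 4 (mod 9)`, and `3` is not a cube mod `7879`
(Euler: `3^((7879−1)/3) = 3^2626 ≢ 1 (mod 7879)`). [cite: HuShuYin2019, Thm. 1.4 (p. 3)] -/
theorem hsy_7879 :
    Nat.Prime 7879 ∧ (7879 % 9 = 4 ∨ 7879 % 9 = 7) ∧ ¬ ∃ x : ZMod 7879, x ^ 3 = 3 :=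
  SylvesterTwoLowerCert.hsy_of_pow_mod_ne_one (by norm_num) (Or.inl rfl) (by decide +kernel)

/-- **LOWER at `p = 7879`, Heegner-INDEX currency.** At every pair of globally minimal models
`B ≅ E_{7879} : x³ + y³ = 7879`, `A ≅ E_{3·7879²}`, the body `MissingLowerBoundAt B 2` of the LOWER child
cruxes holds, from the three route facts + Hu–Shu–Yin's display BY NAME + ONE displayed certificate NOT
proved in the kernel: `hprim` — «at every display datum, Hu–Shu–Yin's point `Y ∈ E_{7879}(K)` is NOT in
`2·E_{7879}(K) + tors`». EVIDENCE for `hprim` (lane bsd-cm-k7t-c3x, HIT2-GEN kit j277664, script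
`hit2gen.gp` sha16 22bcf065df63aaf7, 121-digit evaluation of the CM point on `X_0(243)`): `Y ≡ [13·ζ]P`
(`ζ ∈ μ₆`) modulo `E(K)[3]`, with `P` the generator the SAME computation recovered — first generator of
`E_{7879}(ℚ)` on record (`x(P) = 3268796514194208056907207933508115803/2358674319393634556637366864957889` on
`y² + 7879y = x³ − 7·7879²`, `ĥ = 78.41`; two's N5′-ext: «no generator within 1800 s») — so the
`ℤ₂[ω]`-index of `Y` is odd (`N(13ζ) = 169`): `m(7879) = 0`. Member of the unit subclass 𝒰 (`k = 1`,
`k′ = 0`: both `2`-Selmer groups minimal), where this IS the `𝒱₀` child 19891 at the member. CONDITIONAL;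
EVIDENCE consumer; says nothing about other `p`. [cite: HuShuYin2019, display (bsd) p. 12 with Cor. 4.4, p. 8]
[cite: BurungaleFlach2024, Thm. 1.1 and Cor. 2] [cite: Miller2011LMS, Def. 1.1] -/
theorem missingLowerBoundAt_7879_of_twoPrimitive (hF : Theses.SylvesterTwoHeegnerIndex.PublishedFactsTwo)
    (hH : shaAnPair_mul_height_eq_two_zpow_mul_height)
    (A B : WeierstrassCurve ℚ) [A.IsElliptic] [A.IsGloballyMinimal] [B.IsElliptic] [B.IsGloballyMinimal]
    (hB : ∃ C : VariableChange ℚ, C • B = cubeSumCurve ((7879 : ℕ) : ℚ))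
    (hA : ∃ C : VariableChange ℚ, C • A = cubeSumCurve (3 * ((7879 : ℕ) : ℚ) ^ 2))
    (hprim : ∀ (qB qA : ℚ), shaAn B = (qB : ℂ) → shaAn A = (qA : ℂ) →
      ∀ (K : Type) [Field K] [NumberField K] (ω : K), ω ^ 2 + ω + 1 = 0 → Module.finrank ℚ K = 2 →
      ∀ (P₀ : B.toAffine.Point), ¬ IsOfFinAddOrder (QuadraticDescent.incl K B P₀) →
        (∀ Q : B.toAffine.Point, ∃ m : ℤ,
          IsOfFinAddOrder (QuadraticDescent.incl K B Q - m • QuadraticDescent.incl K B P₀)) →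
      ∀ (Y : (B.baseChange K).toAffine.Point),
        ((qB * qA : ℚ) : ℝ) * canonicalHeight (QuadraticDescent.incl K B P₀) =
          (2 : ℝ) ^ (if (7879 : ℕ) % 9 = 4 then (0 : ℤ) else -2) * canonicalHeight Y →
      ¬ ∃ Y' T' : (B.baseChange K).toAffine.Point, IsOfFinAddOrder T' ∧ Y = (2 : ℤ) • Y' + T') :
    MissingLowerBoundAt B 2 := by
  obtain ⟨hHSY, hCM0, hmod, -⟩ := hF
  exact missingLowerBoundAt_of_twoPrimitive hH hHSY hCM0 hmod hsy_7879.1 rfl hsy_7879.2.2 A B hB hA hprim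

/-- `9643` is an 𝒞_HSY parameter: prime, `9643 ≡ 4 (mod 9)`, `3` not a cube mod `9643`
(`3^3214 ≢ 1 (mod 9643)`). [cite: HuShuYin2019, Thm. 1.4 (p. 3)] -/
theorem hsy_9643 :
    Nat.Prime 9643 ∧ (9643 % 9 = 4 ∨ 9643 % 9 = 7) ∧ ¬ ∃ x : ZMod 9643, x ^ 3 = 3 :=
  SylvesterTwoLowerCert.hsy_of_pow_mod_ne_one (by norm_num) (Or.inl rfl) (by decide +kernel)

/-- **LOWER at `p = 9643`, Heegner-INDEX currency** — same shape as the `7879` row. EVIDENCE for `hprim`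
(HIT2-GEN kit j277664, 145-digit evaluation): `Y ≡ [ζ]P` modulo `E(K)[3]` (`N(ζ) = 1`, `m(9643) = 0`),
`P` the generator recovered by the same computation (`ĥ = 105.95`, 49-digit numerator; two's N5′-ext: «no
generator within 1800 s»); 𝒰-member (`k = 1`, `k′ = 0`), `#Ш(E_{3·9643²}) = 1`. CONDITIONAL; EVIDENCE
consumer. [cite: HuShuYin2019, display (bsd) p. 12 with Cor. 4.4, p. 8] [cite: BurungaleFlach2024, Thm. 1.1 and Cor. 2]
[cite: Miller2011LMS, Def. 1.1] -/
theorem missingLowerBoundAt_9643_of_twoPrimitive (hF : Theses.SylvesterTwoHeegnerIndex.PublishedFactsTwo)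
    (hH : shaAnPair_mul_height_eq_two_zpow_mul_height)
    (A B : WeierstrassCurve ℚ) [A.IsElliptic] [A.IsGloballyMinimal] [B.IsElliptic] [B.IsGloballyMinimal]
    (hB : ∃ C : VariableChange ℚ, C • B = cubeSumCurve ((9643 : ℕ) : ℚ))
    (hA : ∃ C : VariableChange ℚ, C • A = cubeSumCurve (3 * ((9643 : ℕ) : ℚ) ^ 2))
    (hprim : ∀ (qB qA : ℚ), shaAn B = (qB : ℂ) → shaAn A = (qA : ℂ) →
      ∀ (K : Type) [Field K] [NumberField K] (ω : K), ω ^ 2 + ω + 1 = 0 → Module.finrank ℚ K = 2 →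
      ∀ (P₀ : B.toAffine.Point), ¬ IsOfFinAddOrder (QuadraticDescent.incl K B P₀) →
        (∀ Q : B.toAffine.Point, ∃ m : ℤ,
          IsOfFinAddOrder (QuadraticDescent.incl K B Q - m • QuadraticDescent.incl K B P₀)) →
      ∀ (Y : (B.baseChange K).toAffine.Point),
        ((qB * qA : ℚ) : ℝ) * canonicalHeight (QuadraticDescent.incl K B P₀) =
          (2 : ℝ) ^ (if (9643 : ℕ) % 9 = 4 then (0 : ℤ) else -2) * canonicalHeight Y →
      ¬ ∃ Y' T' : (B.baseChange K).toAffine.Point, IsOfFinAddOrder T' ∧ Y = (2 : ℤ) • Y' + T') :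
    MissingLowerBoundAt B 2 := by
  obtain ⟨hHSY, hCM0, hmod, -⟩ := hF
  exact missingLowerBoundAt_of_twoPrimitive hH hHSY hCM0 hmod hsy_9643.1 rfl hsy_9643.2.2 A B hB hA hprim

end Summit.BirchSwinnertonDyer.BirchSwinnertonDyer.Theorems.SylvesterTwoPointIndex

end
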